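import Summits.CriticalPhenomena.Ising3DConformalLimit.Theses.BernsteinTemperature
import Literature.Probability.LatticeModels.DirInvCorrLength
import Literature.Probability.LatticeModels.SharpnessSubcritical

/-!
# Absolute monotonicity in `tanh β` gives the three-temperature inequality

Item stmt-CriticalPhenomena-8361 `MassFromAM` (support, glue) of route `BernsteinTemperature` of the
sub-problem `Ising3DConformalLimit`: `AbsMonotoneTanh → ThreeTemperature`.

**Statement.** If for every `x ∈ ℤ³` the plus-state two-point function is, on `[0, β_c(3))`, a
convergent series `⟨σ₀σ_x⟩⁺_β = Σ_n a_n tanhⁿβ` with `a_n ≥ 0` and `a_n = 0` for `n < L := |x|₁`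
(and for `n ≢ L (mod 2)`), then for all `0 ≤ β ≤ β' ≤ β_c(3)`,
`⟨σ₀σ_x⟩⁺_β · tanh^L β' ≤ ⟨σ₀σ_x⟩⁺_{β'} · tanh^L β`.

**Proof.** Write `v = tanh β ≤ v' = tanh β'` (both `≥ 0`). For `β' < β_c` compare the two
convergent series termwise: for `n = L + k`, `a_n vⁿ v'^L = a_n (v v')^L v^k ≤ a_n (v v')^L v'^k =
a_n v'ⁿ v^L`, and the terms with `n < L` vanish. For `β < β' = β_c` apply this with `β'' ∈ [β, β_c)`
in place of `β'`, bound `⟨σ₀σ_x⟩⁺_{β''} ≤ ⟨σ₀σ_x⟩⁺_{β_c}` (GKS monotonicity in `β`,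
`twoPointPlus_le_twoPointPlus_of_le`), and let `β'' ↑ β_c` using the continuity of `tanh`. The case
`β = β'` is trivial. No definitions are introduced; the result is unconditional glue (the
hypothesis `AbsMonotoneTanh` is the route's crux, taken as an implication, not assumed).

## References

* S. Friedli, Y. Velenik, *Statistical Mechanics of Lattice Systems*, CUP 2017, Lemma 3.31 and
  Exercise 3.9 (monotonicity of the plus state in `β`) [FriedliVelenik2017].
-/

namespace Summit.CriticalPhenomena.Ising3DConformalLimit.BernsteinTemperatureMassFromAM

open Filter Topology
open Literature.Probability.LatticeModels
open Summit.CriticalPhenomena.Ising3DConformalLimit.Theses.BernsteinTemperature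

/-- **Termwise comparison.** For `0 ≤ v ≤ v'`, `a ≥ 0` and `L ≤ n`:
`a vⁿ v'^L ≤ a v'ⁿ v^L`. [folklore] -/
theorem term_le {a v v' : ℝ} (ha : 0 ≤ a) (hv : 0 ≤ v) (hvv' : v ≤ v') {L n : ℕ} (hLn : L ≤ n) :
    a * v ^ n * v' ^ L ≤ a * v' ^ n * v ^ L := by
  obtain ⟨k, rfl⟩ := Nat.exists_eq_add_of_le hLn
  have hv' : 0 ≤ v' := hv.trans hvv'
  have e1 : a * v ^ (L + k) * v' ^ L = a * (v ^ L * v' ^ L) * v ^ k := by rw [pow_add]; ring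
  have e2 : a * v' ^ (L + k) * v ^ L = a * (v ^ L * v' ^ L) * v' ^ k := by rw [pow_add]; ring
  rw [e1, e2]
  exact mul_le_mul_of_nonneg_left (pow_le_pow_left₀ hv hvv' k) (by positivity)

/-- **The strict case** `β' < β_c`: under a non-negative `tanh`-expansion supported on `n ≥ L`,
`⟨σ₀σ_x⟩⁺_β tanh^L β' ≤ ⟨σ₀σ_x⟩⁺_{β'} tanh^L β` for `0 ≤ β ≤ β' < β_c(3)` (termwise comparison
of the two convergent series). [folklore] -/
theorem threeTemperature_of_lt {x : Site 3} {a : ℕ → ℝ} (ha0 : ∀ n, 0 ≤ a n)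
    (hsupp : ∀ n, (n < ∑ i, (x i).natAbs ∨ ¬ Even (n + ∑ i, (x i).natAbs)) → a n = 0)
    (hsum : ∀ β : ℝ, 0 ≤ β → β < criticalBeta 3 →
      HasSum (fun n => a n * Real.tanh β ^ n) (twoPointPlus 3 β x))
    {β β' : ℝ} (hβ : 0 ≤ β) (hββ' : β ≤ β') (hβ'c : β' < criticalBeta 3) :
    twoPointPlus 3 β x * Real.tanh β' ^ (∑ i, (x i).natAbs) ≤
      twoPointPlus 3 β' x * Real.tanh β ^ (∑ i, (x i).natAbs) := by
  have hβc : β < criticalBeta 3 := lt_of_le_of_lt hββ' hβ'c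
  have h1 := (hsum β hβ hβc).mul_right (Real.tanh β' ^ (∑ i, (x i).natAbs))
  have h2 := (hsum β' (hβ.trans hββ') hβ'c).mul_right (Real.tanh β ^ (∑ i, (x i).natAbs))
  refine hasSum_le (fun n => ?_) h1 h2
  by_cases hn : n < ∑ i, (x i).natAbs ∨ ¬ Even (n + ∑ i, (x i).natAbs)
  · simp only [hsupp n hn, zero_mul, le_refl]
  · push Not at hn
    exact term_le (ha0 n) (tanh_nonneg hβ) (tanh_le_tanh hββ') hn.1

/-- **`MassFromAM`** (item stmt-CriticalPhenomena-8361): absolute monotonicity of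
`tanh β ↦ ⟨σ₀σ_x⟩⁺_β` on `[0, β_c(3))` with coefficients supported on `n ≥ |x|₁` implies the
three-temperature inequality `⟨σ₀σ_x⟩⁺_β tanh^{|x|₁} β' ≤ ⟨σ₀σ_x⟩⁺_{β'} tanh^{|x|₁} β` for all
`0 ≤ β ≤ β' ≤ β_c(3)`; the endpoint `β' = β_c` by GKS monotonicity in `β` and continuity of `tanh`.
[cite: FriedliVelenik2017, Lemma 3.31, p. 119] -/
theorem massFromAM_proof : MassFromAM := by
  unfold MassFromAM
  intro hAM x β β' hβ hββ' hβ'c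
  obtain ⟨a, ha0, hsupp, hsum⟩ := hAM x
  rcases lt_or_eq_of_le hβ'c with hlt | heq
  · exact threeTemperature_of_lt ha0 hsupp hsum hβ hββ' hlt
  · rcases lt_or_eq_of_le hββ' with hlt2 | heq2
    · -- `β < β' = β_c`: pass to the limit `β'' ↑ β'`.
      have hbound : ∀ β'' ∈ Set.Ico β β',
          twoPointPlus 3 β x * Real.tanh β'' ^ (∑ i, (x i).natAbs) ≤
            twoPointPlus 3 β' x * Real.tanh β ^ (∑ i, (x i).natAbs) := by
        intro β'' hβ''
        refine (threeTemperature_of_lt ha0 hsupp hsum hβ hβ''.1 (heq ▸ hβ''.2)).trans ?_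
        exact mul_le_mul_of_nonneg_right
          (twoPointPlus_le_twoPointPlus_of_le (hβ.trans hβ''.1) hβ''.2.le x)
          (pow_nonneg (tanh_nonneg hβ) _)
      -- `tanh = sinh / cosh` is continuous (`cosh > 0`).
      have hcont : Continuous Real.tanh := by
        rw [show Real.tanh = fun t => Real.sinh t / Real.cosh t from
          funext Real.tanh_eq_sinh_div_cosh]
        exact Real.continuous_sinh.div Real.continuous_cosh fun t => (Real.cosh_pos t).ne'
      have htend : Tendsto (fun β'' => twoPointPlus 3 β x * Real.tanh β'' ^ (∑ i, (x i).natAbs))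
          (𝓝[<] β') (𝓝 (twoPointPlus 3 β x * Real.tanh β' ^ (∑ i, (x i).natAbs))) :=
        ((continuous_const.mul (hcont.pow _)).tendsto β').mono_left nhdsWithin_le_nhds
      refine le_of_tendsto htend ?_
      filter_upwards [Ico_mem_nhdsLT hlt2] with β'' hβ'' using hbound β'' hβ''
    · subst heq2
      exact le_rfl

end Summit.CriticalPhenomena.Ising3DConformalLimit.BernsteinTemperatureMassFromAM
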